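import Summits.QuantumFields.BalabanUV.T4Continuum.Support.NE7K1LinBlochDenominatorFat

/-!
# NE7K1LinBlochSymbolFloor — row NE7 (node U5), candidate route HOM, path H1L, cell K1-lin(s): NEEDS-ESTIMATE #E1, B-E1 TYPED —
# THE OFF-AXIS REAL-PART FLOOR (clauses (a′)(b′) of lens 2's S-64-1 §3): `Re k_L(u + iη) ≥ k_L(u) − C_S(d)·y²` for real `u` in
# the Brillouin zone and `|η_μ| ≤ y < κ_F(d)`, EVERY `L ≥ 1`, by the Schwarz lemma along the complex line `u + tη̂` (evenness ⇒ no
# linear term); the same for the K1-lin(s) line `(1−s)Δ¹ + s·k_L` with an `s`-free constant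

Lineage `b2b-balaban-t4-ne7-p2` (CRUX PROVER NE7 #2), generation 74; file 51.  File 50 made `k_L = Δ^ξ_L ∕ 𝓝_L` holomorphic and
bounded by `B_F(d) = 16d ∕ c_F(d)` on the FATTENED strip `|Re p_μ| ≤ π + r(d)∕2`, `|Im p_μ| ≤ κ_F(d)`.  Lens 2's clause (S-64-1 §3
(a′)(b′), «the clause gen 58 §4 (iii) called evenness ⇒ second order»): for `u` real in the zone and small imaginary displacement
`iη`, `Re k_L(u + iη) ≥ k_L(u) − C_S·|η|²` — the shifted real-part floors the strip engine consumes for `Δ^ξ`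
(`B4StripCauchy.re_Sxi_ge`-type) transferred to `k_L`.  THIS FILE proves it ([folklore], one complex variable):

* §1 the complex line `lineC u v t = u + t·v` (`|v_μ| ≤ 1`) stays in the fattened strip for `|t| ≤ κ_F(d)`; `g(t) = k_L(u + t·v)` is
  holomorphic on the disc `|t| < κ_F(d)` and bounded by `B_F(d)` there (file 50 BY NAME).
* §2 SCHWARZ TWICE (Mathlib `Complex.norm_dslope_le_div_of_mapsTo_ball`, `Complex.dist_le_div_mul_dist_of_mapsTo_ball`): for a
  function `g` holomorphic on `|t| < R` with `‖g‖ ≤ B`:  `‖g(t) − g(0) − t·g′(0)‖ ≤ (4B∕R²)·|t|²` (`taylor2_of_bounded`).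
* §3 REALITY OF `g′(0)`: `g` is real on real `t` (`kL_ofReal`), so `Im g′(0) = 0` (derivative of the identically-zero imaginary part).
* §4 **`re_kL_ge_sub_sq`**: for `|u_μ| ≤ π`, `0 ≤ y < κ_F(d)`, `|η_μ| ≤ y`, every `L ≥ 1`:
  `k_L(u) − (4B_F(d)∕κ_F(d)²)·y² ≤ Re k_L(u + iη)`; with the window (file 49, not imported) this is the engine's shifted floor shape.
  **`re_line_ge_sub_sq`**: the same for `σ_s = (1−s)Δ¹ + s·k_L`, `s ∈ [0,1]`, constant `max((25∕16)d, 4B_F∕κ_F²)` (`Δ¹`'s part from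
  `B4StripCauchy.re_Sxi_ge` at `n = 1`).

HONEST FRAMING: [folklore]; constants existence-grade and `d`-only (`C_S(4)` astronomically large — irrelevant: the engine's strip
is min-ed against it, as b04 min-s its own `κ₀`); second-derivative bounds not typed (same Cauchy route); R-E1 untouched; nothing of
Bałaban's asserted; no `sorry`.  Census only; NE7 NOT PRINTED ∕ NOT PROVED; spine 0∕9; FIXED FINITE T⁴, rung (B)+1; NOT infinite
volume, NOT mass gap, NOT Clay.  HONEST DEPENDENCY: continuum YM on T⁴ ⇐ BetaPertH ∧ nine spine estimates (0/9 proved); BetaPertH ⇐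
(D1) ∧ (D4) ∧ CAP+tail; G-an2-4 gates asym, D1 and NE2/3/4.
-/

noncomputable section

open Finset Complex Set Metric

namespace Summit.QuantumFields.BalabanUV.T4Continuum.NE7K1LinBlochSymbolFloor

open Literature.MathematicalPhysics.QuantumFieldTheory.Balaban1983to89
open Literature.MathematicalPhysics.QuantumFieldTheory.Balaban1983to89.B4Strip
open Literature.MathematicalPhysics.QuantumFieldTheory.Balaban1983to89.B4StripCauchy
open Literature.MathematicalPhysics.QuantumFieldTheory.Balaban1983to89.B5Strip145Analytic
open NE7K1LinBlochDenominator NE7K1LinBlochDenominatorFat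

variable {d : ℕ}

/-! ### §1 The complex line through a real zone point -/

/-- for `|t| ≤ κ_F(d)`, `|u_μ| ≤ π` and `|v_μ| ≤ 1` the point `u + t·v` lies in the fattened strip of file 50. [folklore] -/
theorem line_mem_fstrip {u v : Fin d → ℝ} (hu : ∀ μ, |u μ| ≤ Real.pi) (hv : ∀ μ, |v μ| ≤ 1) {t : ℂ}
    (ht : ‖t‖ ≤ kappaF d) : (fun ν => (u ν : ℂ) + t * (v ν : ℂ)) ∈ FStrip d (rOf d / 2) (kappaF d) := by
  intro μ
  have hre : ((u μ : ℂ) + t * (v μ : ℂ)).re = u μ + t.re * v μ := by simp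
  have him : ((u μ : ℂ) + t * (v μ : ℂ)).im = t.im * v μ := by simp
  rw [hre, him]
  have h1 : |t.re| ≤ ‖t‖ := abs_re_le_norm t
  have h2 : |t.im| ≤ ‖t‖ := abs_im_le_norm t
  have hκ := kappaF_le d
  have hv0 : 0 ≤ |v μ| := abs_nonneg _
  constructor
  · calc |u μ + t.re * v μ| ≤ |u μ| + |t.re * v μ| := abs_add_le _ _
      _ = |u μ| + |t.re| * |v μ| := by rw [abs_mul]
      _ ≤ Real.pi + kappaF d * 1 := add_le_add (hu μ) (mul_le_mul (h1.trans ht) (hv μ) hv0 (kappaF_pos d).le)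
      _ ≤ Real.pi + rOf d / 2 := by linarith
  · calc |t.im * v μ| = |t.im| * |v μ| := abs_mul _ _
      _ ≤ kappaF d * 1 := mul_le_mul (h2.trans ht) (hv μ) hv0 (kappaF_pos d).le
      _ = kappaF d := mul_one _

/-- the line is an entire function of the parameter `t`. [folklore] -/
theorem differentiableAt_lineC (u v : Fin d → ℝ) (t : ℂ) :
    DifferentiableAt ℂ (fun s : ℂ => fun ν => (u ν : ℂ) + s * (v ν : ℂ)) t :=
  differentiableAt_pi.2 (fun _ => (differentiableAt_const _).add (differentiableAt_id.mul (differentiableAt_const _)))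

/-- `g(t) = k_L(u + t·v)` is holomorphic on the disc `|t| < κ_F(d)`, every `L ≥ 1`. [folklore] -/
theorem differentiableOn_kL_line (L : ℕ) [NeZero L] {u v : Fin d → ℝ} (hu : ∀ μ, |u μ| ≤ Real.pi) (hv : ∀ μ, |v μ| ≤ 1) :
    DifferentiableOn ℂ (fun t : ℂ => kL L (fun ν => (u ν : ℂ) + t * (v ν : ℂ))) (ball (0 : ℂ) (kappaF d)) := by
  intro t ht
  have ht' : ‖t‖ ≤ kappaF d := by rw [mem_ball, dist_zero_right] at ht; exact ht.le
  exact ((differentiableAt_kL_fstrip L (line_mem_fstrip hu hv ht')).comp t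
    (differentiableAt_lineC u v t)).differentiableWithinAt

/-- `‖g(t)‖ ≤ B_F(d) = 16d ∕ c_F(d)` on the closed disc `|t| ≤ κ_F(d)`. [folklore] -/
theorem norm_kL_line_le (L : ℕ) [NeZero L] {u v : Fin d → ℝ} (hu : ∀ μ, |u μ| ≤ Real.pi) (hv : ∀ μ, |v μ| ≤ 1)
    {t : ℂ} (ht : ‖t‖ ≤ kappaF d) : ‖kL L (fun ν => (u ν : ℂ) + t * (v ν : ℂ))‖ ≤ 16 * d / cF d :=
  norm_kL_le_fstrip L (line_mem_fstrip hu hv ht)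

/-! ### §2 Schwarz twice: a second-order Taylor bound from a sup bound -/

/-- **SECOND-ORDER TAYLOR BOUND FROM A SUP BOUND** (Schwarz lemma applied to `g − g(0)` and to the difference quotient):
if `g` is holomorphic on `|t| < R` with `‖g‖ ≤ B` there, then `‖g(t) − g(0) − t·g′(0)‖ ≤ (4B∕R²)·‖t‖²` for `|t| < R`. [folklore] -/
theorem taylor2_of_bounded {g : ℂ → ℂ} {R B : ℝ} (hR : 0 < R) (hd : DifferentiableOn ℂ g (ball (0 : ℂ) R))
    (hB : ∀ t ∈ ball (0 : ℂ) R, ‖g t‖ ≤ B) {t : ℂ} (ht : t ∈ ball (0 : ℂ) R) :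
    ‖g t - g 0 - t * deriv g 0‖ ≤ 4 * B / R ^ 2 * ‖t‖ ^ 2 := by
  have h0 : (0 : ℂ) ∈ ball (0 : ℂ) R := mem_ball_self hR
  have hB0 : 0 ≤ B := (norm_nonneg _).trans (hB 0 h0)
  -- first Schwarz: the difference quotient is bounded by 2B/R
  have hmaps : MapsTo g (ball (0 : ℂ) R) (closedBall (g 0) (2 * B)) := by
    intro s hs
    rw [mem_closedBall, dist_eq_norm]
    calc ‖g s - g 0‖ ≤ ‖g s‖ + ‖g 0‖ := norm_sub_le _ _
      _ ≤ B + B := add_le_add (hB s hs) (hB 0 h0)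
      _ = 2 * B := by ring
  have hq : ∀ s ∈ ball (0 : ℂ) R, ‖dslope g 0 s‖ ≤ 2 * B / R :=
    fun s hs => Complex.norm_dslope_le_div_of_mapsTo_ball hd hmaps hs
  -- second Schwarz on the difference quotient
  set ψ := dslope g 0 with hψ
  have hdψ : DifferentiableOn ℂ ψ (ball (0 : ℂ) R) := (differentiableOn_dslope (ball_mem_nhds _ hR)).mpr hd
  have hmapsψ : MapsTo ψ (ball (0 : ℂ) R) (closedBall (ψ 0) (4 * B / R)) := by
    intro s hs
    rw [mem_closedBall, dist_eq_norm]
    calc ‖ψ s - ψ 0‖ ≤ ‖ψ s‖ + ‖ψ 0‖ := norm_sub_le _ _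
      _ ≤ 2 * B / R + 2 * B / R := add_le_add (hq s hs) (hq 0 h0)
      _ = 4 * B / R := by ring
  have h2 := Complex.dist_le_div_mul_dist_of_mapsTo_ball hdψ hmapsψ ht
  rw [dist_eq_norm, dist_zero_right] at h2
  have hψ0 : ψ 0 = deriv g 0 := by rw [hψ, dslope_same]
  by_cases ht0 : t = 0
  · subst ht0; simp
  have hψt : ψ t = (g t - g 0) / t := by
    rw [hψ, dslope_of_ne _ ht0, slope_def_field, sub_zero]
  have e : g t - g 0 - t * deriv g 0 = t * (ψ t - ψ 0) := by
    rw [hψt, hψ0]; field_simp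
  rw [e, norm_mul]
  calc ‖t‖ * ‖ψ t - ψ 0‖ ≤ ‖t‖ * (4 * B / R / R * ‖t‖) := mul_le_mul_of_nonneg_left h2 (norm_nonneg _)
    _ = 4 * B / R ^ 2 * ‖t‖ ^ 2 := by ring

/-! ### §3 Reality of the derivative at the real point -/

/-- a function `ℂ → ℂ` that is REAL on the reals near `0` and differentiable at `0` has a REAL derivative there. [folklore] -/
theorem im_deriv_eq_zero_of_real {g : ℂ → ℂ} {R : ℝ} (hR : 0 < R) (hd : DifferentiableAt ℂ g 0)
    (hreal : ∀ s : ℝ, |s| < R → (g s).im = 0) : (deriv g 0).im = 0 := by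
  -- `Im g = Re (−i·g)`; differentiate the real part of `−i·g` along the reals (`HasDerivAt.real_of_complex`)
  have h1 : HasDerivAt (fun z => -I * g z) (-I * deriv g 0) ((0 : ℝ) : ℂ) := by
    rw [ofReal_zero]; exact hd.hasDerivAt.const_mul (-I)
  have h3 : HasDerivAt (fun s : ℝ => ((fun z => -I * g z) (s : ℂ)).re) (-I * deriv g 0).re 0 := h1.real_of_complex
  have hev : (fun s : ℝ => ((fun z => -I * g z) (s : ℂ)).re) =ᶠ[nhds (0 : ℝ)] fun _ => (0 : ℝ) := by
    have hO : Ioo (-R) R ∈ nhds (0 : ℝ) := Ioo_mem_nhds (by linarith) hR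
    filter_upwards [hO] with s hs
    have := hreal s (abs_lt.mpr hs)
    simp [this]
  have h4 : HasDerivAt (fun s : ℝ => ((fun z => -I * g z) (s : ℂ)).re) 0 0 :=
    (hasDerivAt_const (0 : ℝ) (0 : ℝ)).congr_of_eventuallyEq hev
  have h5 := h3.unique h4
  simpa using h5

/-- on real parameters the line value of `k_L` is real: `k_L(u + s·v) = kLr_L(u + s v)`. [folklore] -/
theorem kL_line_ofReal (L : ℕ) [NeZero L] (u v : Fin d → ℝ) (s : ℝ) :
    kL L (fun ν => (u ν : ℂ) + (s : ℂ) * (v ν : ℂ)) = ((kLr L (u + s • v) : ℝ) : ℂ) := by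
  rw [← kL_ofReal]
  congr 1
  funext ν
  simp [ofRealVec]

/-! ### §4 The off-axis real-part floor -/

/-- **THE OFF-AXIS REAL-PART FLOOR FOR `k_L` (clauses (a′)(b′) of S-64-1 §3).**  For every `L ≥ 1`, every real `u` in the
Brillouin zone (`|u_μ| ≤ π`), every `0 ≤ y < κ_F(d)` and every real displacement `η` with `|η_μ| ≤ y`:
`k_L(u) − (4·B_F(d)∕κ_F(d)²)·y² ≤ Re k_L(u + iη)`, `B_F(d) = 16d ∕ c_F(d)` — the error is QUADRATIC in the imaginary displacement
because `k_L` is real on the reals (no linear term). [folklore] -/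
theorem re_kL_ge_sub_sq (L : ℕ) [NeZero L] {u η : Fin d → ℝ} (hu : ∀ μ, |u μ| ≤ Real.pi) {y : ℝ} (hy0 : 0 ≤ y)
    (hyR : y < kappaF d) (hη : ∀ μ, |η μ| ≤ y) :
    kLr L u - 4 * (16 * d / cF d) / kappaF d ^ 2 * y ^ 2 ≤ (kL L (fun ν => (u ν : ℂ) + (η ν : ℂ) * I)).re := by
  have hR := kappaF_pos d
  rcases hy0.eq_or_lt with hy | hy
  · -- `y = 0`: `η = 0`, the point is real
    subst hy
    have hη0 : ∀ μ, η μ = 0 := fun μ => abs_nonpos_iff.mp (hη μ)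
    have e : (fun ν => (u ν : ℂ) + (η ν : ℂ) * I) = ofRealVec u := by
      funext ν; simp [ofRealVec, hη0 ν]
    rw [e, kL_ofReal, ofReal_re]
    simp
  -- direction `v = η ∕ y`, parameter `t = iy`
  set v : Fin d → ℝ := fun ν => η ν / y with hvdef
  have hv : ∀ μ, |v μ| ≤ 1 := fun μ => by
    rw [hvdef]; dsimp only; rw [abs_div, abs_of_pos hy, div_le_one hy]; exact hη μ
  set g : ℂ → ℂ := fun t => kL L (fun ν => (u ν : ℂ) + t * (v ν : ℂ)) with hgdef
  have hd : DifferentiableOn ℂ g (ball (0 : ℂ) (kappaF d)) := differentiableOn_kL_line L hu hv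
  have hB : ∀ t ∈ ball (0 : ℂ) (kappaF d), ‖g t‖ ≤ 16 * d / cF d := fun t ht =>
    norm_kL_line_le L hu hv (by rw [mem_ball, dist_zero_right] at ht; exact ht.le)
  have ht : ((y : ℂ) * I) ∈ ball (0 : ℂ) (kappaF d) := by
    rw [mem_ball, dist_zero_right, norm_mul, norm_I, mul_one, norm_real, Real.norm_eq_abs, abs_of_pos hy]
    exact hyR
  have hT := taylor2_of_bounded hR hd hB ht
  -- the point `u + (iy)·v` is `u + iη`, the point `t = 0` is `u`
  have eP : (fun ν => (u ν : ℂ) + ((y : ℂ) * I) * (v ν : ℂ)) = fun ν => (u ν : ℂ) + (η ν : ℂ) * I := by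
    funext ν
    have hy' : (y : ℂ) ≠ 0 := by exact_mod_cast hy.ne'
    have : ((y : ℂ)) * (v ν : ℂ) = (η ν : ℂ) := by
      rw [hvdef]; dsimp only; push_cast
      rw [mul_div_assoc', mul_div_cancel_left₀ _ hy']
    calc (u ν : ℂ) + (y : ℂ) * I * (v ν : ℂ) = (u ν : ℂ) + ((y : ℂ) * (v ν : ℂ)) * I := by ring
      _ = (u ν : ℂ) + (η ν : ℂ) * I := by rw [this]
  have eg0 : g 0 = ((kLr L u : ℝ) : ℂ) := by
    have := kL_line_ofReal L u v 0
    simp only [ofReal_zero, zero_smul, add_zero] at this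
    exact this
  -- reality of `g′(0)`
  have him : (deriv g 0).im = 0 := by
    refine im_deriv_eq_zero_of_real hR (hd.differentiableAt (ball_mem_nhds _ hR)) (fun s _ => ?_)
    show (kL L (fun ν => (u ν : ℂ) + (s : ℂ) * (v ν : ℂ))).im = 0
    rw [kL_line_ofReal, ofReal_im]
  -- assemble: Re g(iy) ≥ Re g(0) + Re(iy·g′(0)) − (4B∕R²) y²
  have hnorm : ‖(y : ℂ) * I‖ = y := by
    rw [norm_mul, norm_I, mul_one, norm_real, Real.norm_eq_abs, abs_of_pos hy]
  rw [hnorm] at hT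
  have hre : |(g ((y : ℂ) * I) - g 0 - (y : ℂ) * I * deriv g 0).re| ≤ 4 * (16 * d / cF d) / kappaF d ^ 2 * y ^ 2 :=
    (abs_re_le_norm _).trans hT
  have hlin : ((y : ℂ) * I * deriv g 0).re = 0 := by
    simp [him]
  have hgy : g ((y : ℂ) * I) = kL L (fun ν => (u ν : ℂ) + (η ν : ℂ) * I) := by
    rw [hgdef]; dsimp only; rw [eP]
  rw [sub_re, sub_re, hlin, sub_zero, hgy, eg0, ofReal_re] at hre
  have := (abs_le.mp hre).1
  linarith

/-- the real-part floor of the unit-lattice Laplacian symbol off the axis: `Re Δ¹(u + iη) ≥ Δ¹(u) − (25∕16)·d·y²` for `|η_μ| ≤ y ≤ 1`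
(`B4StripCauchy.re_Sxi_ge` at `n = 1`). [folklore] -/
theorem re_Delta1_ge_sub_sq {u η : Fin d → ℝ} {y : ℝ} (hy1 : y ≤ 1) (hη : ∀ μ, |η μ| ≤ y) :
    Delta1r 0 u - 25 / 16 * d * y ^ 2 ≤ (Delta1 0 (fun ν => (u ν : ℂ) + (η ν : ℂ) * I)).re := by
  have hterm : ∀ μ, S1r (u μ) - 25 / 16 * y ^ 2 ≤ (S1 ((u μ : ℂ) + (η μ : ℂ) * I)).re := by
    intro μ
    have hz : |((u μ : ℂ) + (η μ : ℂ) * I).im| ≤ 1 := by simp; exact (hη μ).trans hy1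
    have h := re_Sxi_ge 1 le_rfl ((u μ : ℂ) + (η μ : ℂ) * I) hz
    rw [← S1_eq_Sxi_one] at h
    have hre : ((u μ : ℂ) + (η μ : ℂ) * I).re = u μ := by simp
    have him : ((u μ : ℂ) + (η μ : ℂ) * I).im = η μ := by simp
    rw [hre, him] at h
    have hS : S1r (u μ) = 4 * (1 : ℝ) ^ 2 * Real.sin (u μ / (2 * (1 : ℕ))) ^ 2 := by
      rw [S1r_eq]; push_cast; ring_nf
    have hη2 : η μ ^ 2 ≤ y ^ 2 := by
      rw [← sq_abs]; exact pow_le_pow_left₀ (abs_nonneg _) (hη μ) 2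
    push_cast at h
    rw [hS]; push_cast
    nlinarith
  unfold Delta1r Delta1
  push_cast
  rw [add_zero, add_zero, Complex.re_sum]
  have := Finset.sum_le_sum (fun μ (_ : μ ∈ Finset.univ) => hterm μ)
  rw [Finset.sum_sub_distrib, Finset.sum_const, Finset.card_univ, Fintype.card_fin, nsmul_eq_mul] at this
  linarith

/-- **THE OFF-AXIS REAL-PART FLOOR FOR THE K1-lin(s) LINE**, uniformly in `s ∈ [0,1]` and `L ≥ 1`: for `|u_μ| ≤ π`,
`0 ≤ y < κ_F(d)`, `|η_μ| ≤ y`:  `σ_s(u) − max((25∕16)d, 4B_F(d)∕κ_F(d)²)·y² ≤ Re σ_s(u + iη)`, `σ_s = (1−s)Δ¹ + s·k_L`. [folklore] -/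
theorem re_line_ge_sub_sq (L : ℕ) [NeZero L] {s : ℝ} (hs0 : 0 ≤ s) (hs1 : s ≤ 1) {u η : Fin d → ℝ}
    (hu : ∀ μ, |u μ| ≤ Real.pi) {y : ℝ} (hy0 : 0 ≤ y) (hyR : y < kappaF d) (hη : ∀ μ, |η μ| ≤ y) :
    ((1 - s) * Delta1r 0 u + s * kLr L u) - max (25 / 16 * (d : ℝ)) (4 * (16 * d / cF d) / kappaF d ^ 2) * y ^ 2
      ≤ ((1 - (s : ℂ)) * Delta1 0 (fun ν => (u ν : ℂ) + (η ν : ℂ) * I)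
          + (s : ℂ) * kL L (fun ν => (u ν : ℂ) + (η ν : ℂ) * I)).re := by
  have hy1 : y ≤ 1 := by have := kappaF_le_eighth d; linarith
  have h1 := re_Delta1_ge_sub_sq (u := u) hy1 hη
  have h2 := re_kL_ge_sub_sq L hu hy0 hyR hη
  set A : ℝ := 25 / 16 * (d : ℝ) with hA
  set B : ℝ := 4 * (16 * d / cF d) / kappaF d ^ 2 with hB
  set M : ℝ := max A B with hM
  have hm1 : A ≤ M := le_max_left _ _
  have hm2 : B ≤ M := le_max_right _ _
  have hy2 : 0 ≤ y ^ 2 := sq_nonneg y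
  have hs1' : 0 ≤ 1 - s := by linarith
  have e : ((1 - (s : ℂ)) * Delta1 0 (fun ν => (u ν : ℂ) + (η ν : ℂ) * I)
          + (s : ℂ) * kL L (fun ν => (u ν : ℂ) + (η ν : ℂ) * I)).re
      = (1 - s) * (Delta1 0 (fun ν => (u ν : ℂ) + (η ν : ℂ) * I)).re
          + s * (kL L (fun ν => (u ν : ℂ) + (η ν : ℂ) * I)).re := by
    simp [sub_mul]
  rw [e]
  have k1 := mul_le_mul_of_nonneg_left h1 hs1'
  have k2 := mul_le_mul_of_nonneg_left h2 hs0
  have k5 : 0 ≤ ((1 - s) * (M - A) + s * (M - B)) * y ^ 2 :=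
    mul_nonneg (add_nonneg (mul_nonneg hs1' (sub_nonneg.mpr hm1)) (mul_nonneg hs0 (sub_nonneg.mpr hm2))) hy2
  have eL : (1 - s) * Delta1r 0 u + s * kLr L u - M * y ^ 2
      = (1 - s) * (Delta1r 0 u - A * y ^ 2) + s * (kLr L u - B * y ^ 2)
        - ((1 - s) * (M - A) + s * (M - B)) * y ^ 2 := by ring
  rw [eL]
  linarith

end Summit.QuantumFields.BalabanUV.T4Continuum.NE7K1LinBlochSymbolFloor

end
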